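import Literature.Geometry.Lorentzian.ConformalScalarFlatSign
import Literature.Geometry.Lorentzian.HopfPositivity
import Literature.Geometry.Lorentzian.EndFluxFormula
import Literature.Geometry.Lorentzian.RicciDecay
import HarnessLib

/-!
# Schoen–Yau 1979, Cor. 3.1 from the existence of the conformal factor alone

`ConformalScalarFlatSign.lean` reduces the named fact `exists_conformal_negativeMass_of_massZero`
(Schoen–Yau, Comm. Math. Phys. 65 (1979), Cor. 3.1, p. 72) to the *elliptic core* of
Lemmas 3.2–3.3 (`exists_conformal_negativeMass_of_massZero_of_ellipticCore`): for all admissible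
data, a smooth `φ > 0` with `Δ_h φ = Rφ/8` ((3.22)), `Rφ ∈ L¹`, `A = −(1/32π) ∫ Rφ dV` ((3.16))
and `φ = 1 + A/r + O₂(r⁻²)` ((3.17)–(3.18), (3.20)). Three of these five conclusions are
consequences of the other two, by results now proved in the tree:

* positivity `φ > 0` — E. Hopf's minimum principle for `−Δ_h + R/8`
  (`pos_of_dalembertian_le_of_pos_off_isCompact`, `HopfPositivity.lean`; Schoen–Yau: "the Hopf
  maximum principle implies `φ > 0`"), since `φ → 1` along the only end;
* integrability of `Rφ` — `R ∈ L¹(dV_h)` on one-ended data with `h − δ = o₅(r⁻²)` and `φ` is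
  bounded (`integrable_scalarCurvature_mul_of_tendstoAtEnd`, `ScalarCurvatureIntegrable.lean`);
* the mass formula `A = −(1/32π) ∫ Rφ dV` — the flux formula `∫ Δ_h φ dV = −4πA` for
  `φ = 1 + A/r + O₁(r⁻²)` (`AFEnd.integral_dalembertian_eq_of_expansion'`, `EndFluxFormula.lean`;
  Schoen–Yau's (3.16)) with `Δ_h φ = Rφ/8`.

Hence (`exists_conformal_negativeMass_of_massZero_of_solution`) **Cor. 3.1 follows from the bare
existence statement**: for all admissible `(X, h, e)` with `R ≥ 0` there are a smooth `φ` and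
`A ∈ ℝ` with `Δ_h φ = Rφ/8` on `X` and `φ = 1 + A/r + O₂(r⁻²)` in the chart of the end — the
solution of the linear equation (3.23) by Lemma 3.2 (existence, regularity and asymptotics), which is
what remains of Schoen–Yau's §3 for this corollary. No named facts are introduced; the auxiliary
`AFEnd.not_isCompact_univ` (a manifold with an asymptotically flat end is not compact) and
`AFEnd.far_nonempty` are proved here.

## References

* R. Schoen, S.-T. Yau, *On the proof of the positive mass conjecture in general relativity*,
  Comm. Math. Phys. 65 (1979) 45–76: Lemma 3.2 with (3.16)–(3.18), (3.20); Lemma 3.3 with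
  (3.22)–(3.23); Cor. 3.1 (p. 72).
-/

noncomputable section

open Set Function Filter Metric MeasureTheory Measure TopologicalSpace Bornology Asymptotics Manifold
  Bundle
open scoped Topology Manifold ContDiff

namespace Literature.Geometry.Lorentzian

namespace AFEnd

variable {X : Type} [TopologicalSpace X] [ChartedSpace E3 X]

/-- Points of the exterior region with large radius give points of every far region. [folklore] -/
theorem dataChart_mem_far (e : AFEnd X) {ρ : ℝ} {z : exteriorRegion e.R} (hz : ρ < ‖(z : E3)‖) :
    e.dataChart z ∈ e.far ρ :=
  e.mem_far_iff.2 ⟨z, hz, rfl⟩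

/-- **Every far region is nonempty** (it contains `Φ z` for `‖z‖` large). [folklore] -/
theorem far_nonempty (e : AFEnd X) (ρ : ℝ) : (e.far ρ).Nonempty := by
  set t : ℝ := max ρ e.R + 1 with ht
  have htR : e.R < t := by
    have := le_max_right ρ e.R
    linarith
  have htρ : ρ < t := by
    have := le_max_left ρ e.R
    linarith
  have ht0 : 0 < t := e.R_pos.trans htR
  set z : E3 := t • EuclideanSpace.single (0 : Fin 3) (1 : ℝ) with hz
  have hzn : ‖z‖ = t := by
    rw [hz, norm_smul, Real.norm_of_nonneg ht0.le]
    simp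
  exact ⟨e.dataChart ⟨z, by rw [mem_exteriorRegion, hzn]; exact htR⟩,
    e.dataChart_mem_far (by change ρ < ‖z‖; rw [hzn]; exact htρ)⟩

/-- **A manifold with an asymptotically flat end is not compact**: the closed far piece
`{q ∈ U | R + 1 ≤ ‖coord q‖}` is closed in `X` (end axiom `isClosed_far`) and is mapped by the
continuous coordinate map onto the unbounded set `{R + 1 ≤ ‖z‖}`. [folklore] -/
theorem not_isCompact_univ (e : AFEnd X) : ¬ IsCompact (univ : Set X) := by
  intro hX
  set S : Set X := ((↑) : e.U → X) '' (e.chart ⁻¹' {x | e.R + 1 ≤ ‖(x : E3)‖}) with hS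
  have hSc : IsCompact S := hX.of_isClosed_subset (e.isClosed_far (e.R + 1) (by linarith)) (subset_univ _)
  have hSU : S ⊆ (e.U : Set X) := by
    rintro _ ⟨u, -, rfl⟩
    exact u.2
  have hcont : ContinuousOn e.coord (e.U : Set X) := fun q hq ↦
    (e.contMDiffAt_coord hq).continuousAt.continuousWithinAt
  have himg : IsCompact (e.coord '' S) := hSc.image_of_continuousOn (hcont.mono hSU)
  obtain ⟨C, hC⟩ := himg.isBounded.exists_norm_le
  -- a point of the image of norm larger than `C`
  set t : ℝ := max C (e.R + 1) + 1 with ht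
  have htR : e.R < t := by
    have := le_max_right C (e.R + 1)
    linarith
  have ht0 : 0 < t := e.R_pos.trans htR
  set z : E3 := t • EuclideanSpace.single (0 : Fin 3) (1 : ℝ) with hz
  have hzn : ‖z‖ = t := by
    rw [hz, norm_smul, Real.norm_of_nonneg ht0.le]
    simp
  have hzR : e.R < ‖z‖ := by rw [hzn]; exact htR
  set q : X := e.dataChart ⟨z, hzR⟩ with hq
  have hqU : q ∈ e.U := (e.chart.symm ⟨z, hzR⟩).2
  have hcoord : e.coord q = z := e.coord_dataChart ⟨z, hzR⟩
  have hqS : q ∈ S := by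
    refine ⟨⟨q, hqU⟩, ?_, rfl⟩
    change e.R + 1 ≤ ‖(e.chart ⟨q, hqU⟩ : E3)‖
    rw [← e.coord_of_mem hqU, hcoord, hzn]
    have := le_max_right C (e.R + 1)
    linarith
  have hle := hC z ⟨q, hqS, hcoord⟩
  rw [hzn] at hle
  have := le_max_left C (e.R + 1)
  linarith

end AFEnd

/-! ### Cor. 3.1 from the existence of the conformal factor -/

/-- **Cor. 3.1 from the existence of the conformal factor alone.** The named fact
`exists_conformal_negativeMass_of_massZero` (Schoen–Yau, Comm. Math. Phys. 65 (1979), Cor. 3.1,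
p. 72) follows from the existence, for all admissible `(X, h, e)` with `R ≥ 0` (`X` oriented,
`h − δ = o₅(r⁻²)` in the chart of `e`, one end), of a smooth `φ` and `A ∈ ℝ` with
`Δ_h φ = Rφ/8` on `X` ((3.22)) and `φ = 1 + A/r + O₂(r⁻²)` in the chart of the end
((3.17)–(3.18) with (3.20); the solution of (3.23) by Lemma 3.2). The remaining conclusions of the
elliptic core are supplied by the tree: `φ > 0` by E. Hopf's minimum principle for `−Δ_h + R/8`
(`pos_of_dalembertian_le_of_pos_off_isCompact`: `φ → 1` along the only end, so `φ > 0` off a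
compact set, and `X` is not compact), `Rφ ∈ L¹` by `integrable_scalarCurvature_mul_of_tendstoAtEnd`,
and `A = −(1/32π) ∫ Rφ dV` by the flux formula `∫ Δ_h φ dV = −4πA`
(`AFEnd.integral_dalembertian_eq_of_expansion'`, Schoen–Yau's (3.16)) with `Δ_h φ = Rφ/8`; then
`exists_conformal_negativeMass_of_massZero_of_ellipticCore` applies.
[cite: SchoenYauPMT1979, Cor. 3.1 (p. 72) with Lemma 3.2 (3.16)–(3.18) and Lemma 3.3 (3.22)–(3.23)] -/
theorem exists_conformal_negativeMass_of_massZero_of_solution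
    (hsol : ∀ (X : Type) [TopologicalSpace X] [ChartedSpace E3 X] [IsManifold (𝓡 3) ∞ X]
      [T2Space X] [SecondCountableTopology X] [LocallyCompactSpace X] [ConnectedSpace X]
      [MeasurableSpace X] [BorelSpace X]
      (D : InitialDataSet (𝓡 3) X) [D.metric.HasLeviCivita] (e : AFEnd X),
      Literature.Topology.FourManifolds.IsOrientable (𝓡 3) X →
      e.IsStronglyAsymptoticallyFlatWith D 0 2 0 5 0 → e.IsSoleEnd →
      (∀ x : X, 0 ≤ D.metric.scalarCurvature x) →
      ∃ (φ : X → ℝ) (A : ℝ), ContMDiff (𝓡 3) 𝓘(ℝ) ∞ φ ∧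
        (∀ x, D.metric.dalembertian φ x = D.metric.scalarCurvature x * φ x / 8) ∧
        ∀ m : ℕ, m ≤ 2 →
          (fun x ↦ ‖iteratedFDeriv ℝ m (fun y ↦ endValue e φ y - (1 + A / ‖y‖)) x‖)
            =O[cobounded E3] fun x ↦ ‖x‖ ^ (-2 - m : ℝ)) :
    exists_conformal_negativeMass_of_massZero := by
  refine exists_conformal_negativeMass_of_massZero_of_ellipticCore ?_
  intro X _ _ _ _ _ _ _ _ _ D _ e hor haf hsole hR0
  obtain ⟨φ, A, hφs, hpde, hexp⟩ := hsol X D e hor haf hsole hR0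
  have hφc : Continuous φ := hφs.continuous
  have hφ2 : ContMDiff (𝓡 3) 𝓘(ℝ, ℝ) 2 φ := hφs.of_le (WithTop.coe_le_coe.mpr le_top)
  -- (a) `φ → 1` at infinity, from the order-zero part of the expansion
  have hlim : TendstoAtEnd e φ 1 := by
    have h0 := hexp 0 (Nat.zero_le _)
    have hr : Tendsto (fun x : E3 ↦ ‖x‖ ^ (-2 - (0 : ℕ) : ℝ)) (cobounded E3) (𝓝 0) := by
      simp only [Nat.cast_zero, sub_zero]
      exact (tendsto_rpow_neg_atTop (by norm_num : (0 : ℝ) < 2)).comp tendsto_norm_cobounded_atTop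
    have hdiff : Tendsto (fun y : E3 ↦ endValue e φ y - (1 + A / ‖y‖)) (cobounded E3) (𝓝 0) := by
      have h := h0.trans_tendsto hr
      rw [tendsto_zero_iff_norm_tendsto_zero]
      refine h.congr fun x ↦ ?_
      rw [norm_iteratedFDeriv_zero]
    have hA : Tendsto (fun y : E3 ↦ 1 + A / ‖y‖) (cobounded E3) (𝓝 (1 + 0)) :=
      tendsto_const_nhds.add ((tendsto_const_nhds (x := A)).div_atTop tendsto_norm_cobounded_atTop)
    rw [add_zero] at hA
    have := hdiff.add hA
    simp only [zero_add, sub_add_cancel] at this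
    exact this
  -- (b) positivity: `φ > 0` off a compact set, hence everywhere (Hopf)
  have hpos : ∀ x, 0 < φ x := by
    -- far out `φ > 1/2`
    have hev : ∀ᶠ y in cobounded E3, 1 / 2 < endValue e φ y :=
      (Metric.tendsto_nhds.1 hlim) (1 / 2) (by norm_num) |>.mono fun y hy ↦ by
        rw [Real.dist_eq, abs_lt] at hy
        linarith
    obtain ⟨R₀, -, hR₀⟩ := (hasBasis_cobounded_norm (E := E3)).eventually_iff.1 hev
    have hfar : ∀ q ∈ e.far (max R₀ e.R), 0 < φ q := by
      intro q hq
      obtain ⟨z, hz, rfl⟩ := e.mem_far_iff.1 hq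
      have h1 := hR₀ (show (z : E3) ∈ {x | R₀ ≤ ‖x‖} from (le_max_left _ _).trans hz.le)
      rw [endValue_of_lt e φ z.2] at h1
      have h2 : φ (e.dataChart z) = φ (e.dataChart ⟨z, z.2⟩) := rfl
      rw [h2]
      linarith
    obtain ⟨K, hK, hcover⟩ := hsole.exists_isCompact_cover (max R₀ e.R)
    have hne : Kᶜ.Nonempty := by
      by_contra h
      rw [not_nonempty_iff_eq_empty, compl_empty_iff] at h
      exact e.not_isCompact_univ (h ▸ hK)
    refine D.metric.pos_of_dalembertian_le_of_pos_off_isCompact D.isRiemannian_metric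
      (c := fun x ↦ D.metric.scalarCurvature x / 8)
      ((D.metric.contMDiff_scalarCurvature.continuous).div_const 8)
      (fun x ↦ div_nonneg (hR0 x) (by norm_num)) hφ2
      (fun x ↦ by rw [hpde x]; exact le_of_eq (by ring)) hK
      (fun x hx ↦ ?_) hne
    rcases hcover x with h | h
    · exact absurd h hx
    · exact hfar x h
  -- (c) integrability of `R φ`
  have hint : Integrable (fun x ↦ D.metric.scalarCurvature x * φ x) (riemannianMeasure D.h) :=
    integrable_scalarCurvature_mul_of_tendstoAtEnd D e haf hsole hφc hlim
  -- (d) the mass formula from the flux formula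
  have hAF : e.IsMetricAsymptoticallyFlat D 2 :=
    AFEnd.IsStronglyAsymptoticallyFlatWith.isMetricAsymptoticallyFlat_of_massZero e D haf (by norm_num)
  have hΔint : Integrable (D.metric.dalembertian φ) (riemannianMeasure D.h) := by
    exact (hint.div_const 8).congr (Eventually.of_forall fun x ↦ (hpde x).symm)
  have hflux := e.integral_dalembertian_eq_of_expansion' D two_pos hAF hsole hφ2 hΔint hexp
  have hA : A = -(32 * Real.pi)⁻¹ * ∫ x, D.metric.scalarCurvature x * φ x ∂(riemannianMeasure D.h) := by
    have h8 : ∫ x, D.metric.dalembertian φ x ∂(riemannianMeasure D.h) =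
        (∫ x, D.metric.scalarCurvature x * φ x ∂(riemannianMeasure D.h)) / 8 := by
      rw [← integral_div]
      exact integral_congr_ae (Eventually.of_forall fun x ↦ hpde x)
    rw [h8] at hflux
    have hπ : Real.pi ≠ 0 := Real.pi_ne_zero
    have hI : ∫ x, D.metric.scalarCurvature x * φ x ∂(riemannianMeasure D.h) =
        -(32 * Real.pi * A) := by linarith
    rw [hI]
    field_simp
  exact ⟨φ, A, hφs, hpos, hpde, hint, hA, hexp⟩

end Literature.Geometry.Lorentzian

end
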